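import Summits.Ventures.LatticeQCDFlow.Scoring.BlockFactorCLT

/-!
# The CLT for a moving average of ANY i.i.d. square-integrable sequence: `(√N)⁻¹ Σ_{i<N} (X_i − E X_0) ⇒ N(0, Var(ξ₀) (Σ_j a_j)²)`

HONEST FRAMING: exact (Metropolis-corrected) sampling algorithms for lattice gauge theory;
figures of merit are autocorrelation/cost numbers at stated couplings and volumes; no
continuum-physics claim.

Venture `LatticeQCDFlow` (cell pub-lqcd), sub-topic `Scoring`; FANOUT row 16 (`su2-base`), GEN-7.
NEW WORK of the cell over `Scoring/BlockFactorCLT`; nothing is cited as a fact.  Printed counterpart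
NAMED ONLY: Lehmann 1999 Example 2.8.1, eqs. (2.8.7)–(2.8.8) and Problem 8.3 (moving averages; held,
p. 93).

A file of the LAW-OF-THE-ERROR packet: the first concrete instance of the `m`-dependent CLT, with the
long-run variance in CLOSED FORM and NO Gaussian assumption — the moving average `X_i = Σ_{j≤m} a_j ξ_{i+j}`
of an i.i.d. square-integrable sequence (binned / smoothed series of independent draws).  The
combinatorial identity `(Σ a_j)² = γ(0) + 2Σ_{n≥1} γ(n)` proved here is reused by `GaussianMovingAverage`.

## Contents

* `maMap a` (`w ↦ Σ_j a_j w_j`), `measurable_maMap`, `blockFactor_maMap` (`X_i = Σ_j a_j ξ_{i+j}`),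
  `maACF a n = Σ_{j,j'} [j = n + j'] a_j a_{j'}` (`γ(n)` at unit innovation variance), `maCov a i k`
  (`Σ [i+j = k+j'] a_j a_{j'}`), `maACF_eq_zero` (`n > m`), `maACF_zero` (`= Σ a_j²`), `maACF_zero_pos`
  (`a ≠ 0`), **`maCov_eq_maACF`** (`maCov a i k = γ(|k − i|)`), `summable_maACF_div`.
* `sum_indicator_pair_eq_one`, **`sq_sum_eq_lrVar_maACF`** — `(Σ_j a_j)² = lrVar (maACF a) m`.
* `memLp_blockFactor_maMap`, `covariance_iid` (`cov[ξ_p, ξ_q] = Var(ξ_0)[p = q]`),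
  **`covariance_blockFactor_maMap`** (`cov[X_0, X_k] = Var(ξ_0) γ(k)`), **`lrVar_blockFactor_maMap`**
  (`σ² = Var(ξ_0)(Σ_j a_j)²`), **`tendstoInDistribution_movingAverage`** — THE CLT for the moving
  average of an i.i.d. `L²` sequence, any innovation law.

NOT CLAIMED: `MA(∞)`; the degenerate case `Σ a_j = 0` is included (limit = point mass, `σ² = 0`).
-/

noncomputable section

open MeasureTheory ProbabilityTheory Filter Finset
open scoped Topology NNReal

namespace Summit.Ventures.LatticeQCDFlow.Scoring

/-! ## The moving-average factor map and its covariance -/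

section MA

variable {m : ℕ}

/-- The MOVING-AVERAGE factor map `w ↦ Σ_{j ≤ m} a_j w_j` (so `blockFactor (maMap a) ξ i = Σ_j a_j ξ_{i+j}`,
an `MA(m)` process driven by `ξ`). [ours] -/
def maMap (a : Fin (m + 1) → ℝ) : (Fin (m + 1) → ℝ) → ℝ := fun w => ∑ j, a j * w j

/-- `maMap` is measurable. -/
theorem measurable_maMap (a : Fin (m + 1) → ℝ) : Measurable (maMap a) :=
  Finset.measurable_sum _ fun j _ => (measurable_pi_apply j).const_mul _

/-- `X_i = Σ_j a_j ξ_{i+j}`. -/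
theorem blockFactor_maMap {Ω : Type*} (a : Fin (m + 1) → ℝ) (ξ : ℕ → Ω → ℝ) (i : ℕ) (ω : Ω) :
    blockFactor (maMap a) ξ i ω = ∑ j : Fin (m + 1), a j * ξ (i + j) ω := rfl

/-- The MA AUTOCOVARIANCE at lag `n`: `γ(n) = Σ_{j'} a_{n+j'} a_{j'}` (zero for `n > m`). [ours] -/
def maACF (a : Fin (m + 1) → ℝ) (n : ℕ) : ℝ :=
  ∑ j : Fin (m + 1), ∑ j' : Fin (m + 1), if (j : ℕ) = n + j' then a j * a j' else 0

/-- The MA second moments `E[X_i X_k] = Σ_{j,j'} a_j a_{j'} [i + j = k + j']`. [ours] -/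
def maCov (a : Fin (m + 1) → ℝ) (i k : ℕ) : ℝ :=
  ∑ j : Fin (m + 1), ∑ j' : Fin (m + 1), if i + (j : ℕ) = k + j' then a j * a j' else 0

/-- `γ` vanishes beyond lag `m`. -/
theorem maACF_eq_zero (a : Fin (m + 1) → ℝ) {n : ℕ} (hn : m < n) : maACF a n = 0 := by
  refine sum_eq_zero fun j _ => sum_eq_zero fun j' _ => ?_
  rw [if_neg]
  have := j.isLt
  omega

/-- `γ(0) = Σ_j a_j²`. -/
theorem maACF_zero (a : Fin (m + 1) → ℝ) : maACF a 0 = ∑ j, a j ^ 2 := by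
  simp only [maACF, zero_add, Fin.val_eq_val]
  refine sum_congr rfl fun j _ => ?_
  rw [sum_ite_eq, if_pos (mem_univ _), sq]

/-- `γ(0) > 0` unless all coefficients vanish. -/
theorem maACF_zero_pos {a : Fin (m + 1) → ℝ} (ha : a ≠ 0) : 0 < maACF a 0 := by
  rw [maACF_zero]
  obtain ⟨j, hj⟩ : ∃ j, a j ≠ 0 := Function.ne_iff.mp ha
  exact lt_of_lt_of_le (by positivity : 0 < a j ^ 2)
    (single_le_sum (f := fun j => a j ^ 2) (fun i _ => sq_nonneg _) (mem_univ j))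

/-- **Stationarity of the MA second moments**: `E[X_i X_k] = γ(|k − i|)`. -/
theorem maCov_eq_maACF (a : Fin (m + 1) → ℝ) (i k : ℕ) :
    maCov a i k = maACF a (((k : ℤ) - i).natAbs) := by
  rcases le_or_gt i k with h | h
  · obtain ⟨n, rfl⟩ := Nat.exists_eq_add_of_le h
    have e : (((i + n : ℕ) : ℤ) - i).natAbs = n := by omega
    rw [e, maCov, maACF]
    refine sum_congr rfl fun j _ => sum_congr rfl fun j' _ => ?_
    congr 1
    simp only [eq_iff_iff]
    omega
  · obtain ⟨n, rfl⟩ := Nat.exists_eq_add_of_le h.le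
    have e : (((k : ℕ) : ℤ) - (k + n : ℕ)).natAbs = n := by omega
    rw [e, maCov, maACF, sum_comm]
    refine sum_congr rfl fun j _ => sum_congr rfl fun j' _ => ?_
    rw [mul_comm]
    congr 1
    simp only [eq_iff_iff]
    omega

/-- `ρ = γ/γ(0)` is finitely supported, hence summable. -/
theorem summable_maACF_div (a : Fin (m + 1) → ℝ) : Summable fun n => maACF a n / maACF a 0 := by
  refine summable_of_ne_finset_zero (s := range (m + 1)) fun n hn => ?_
  rw [maACF_eq_zero a (by simp only [mem_range, not_lt] at hn; omega), zero_div]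

end MA

/-! ## `(Σ_j a_j)² = γ(0) + 2 Σ_{n=1}^{m} γ(n)` -/

section Combinatorics

variable {m : ℕ}

/-- For every pair `(j, j')` exactly one of `j = n + j'` (`0 ≤ n ≤ m`) or `j' = (n+1) + j` (`0 ≤ n < m`)
holds. -/
theorem sum_indicator_pair_eq_one (j j' : Fin (m + 1)) :
    (∑ n ∈ range (m + 1), if (j : ℕ) = n + j' then (1 : ℝ) else 0)
      + (∑ n ∈ range m, if (j' : ℕ) = n + 1 + j then (1 : ℝ) else 0) = 1 := by
  have hj := j.isLt
  have hj' := j'.isLt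
  rcases le_or_gt (j' : ℕ) j with h | h
  · rw [Finset.sum_eq_single ((j : ℕ) - j') (fun n _ hn => if_neg (by omega))
        (fun hn => absurd (mem_range.2 (by omega)) hn), if_pos (by omega),
      sum_eq_zero (fun n _ => if_neg (by omega)), add_zero]
  · rw [sum_eq_zero (fun n _ => if_neg (by omega)), zero_add,
      Finset.sum_eq_single ((j' : ℕ) - j - 1) (fun n _ hn => if_neg (by omega))
        (fun hn => absurd (mem_range.2 (by omega)) hn), if_pos (by omega)]

/-- **`(Σ_j a_j)² = γ(0) + 2 Σ_{n=1}^{m} γ(n)`**: the long-run variance of a moving average with unit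
innovation variance is the squared sum of its coefficients. -/
theorem sq_sum_eq_lrVar_maACF (a : Fin (m + 1) → ℝ) :
    (∑ j, a j) ^ 2 = lrVar (maACF a) m := by
  rw [lrVar, sq, sum_mul_sum]
  -- insert the partition of unity and split
  have e : ∀ j j' : Fin (m + 1), a j * a j'
      = (∑ n ∈ range (m + 1), if (j : ℕ) = n + j' then a j * a j' else 0)
        + (∑ n ∈ range m, if (j' : ℕ) = n + 1 + j then a j * a j' else 0) := by
    intro j j'
    have h := congrArg (fun x : ℝ => a j * a j' * x) (sum_indicator_pair_eq_one j j')
    simp only [mul_add, mul_sum, mul_ite, mul_one, mul_zero] at h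
    exact h.symm
  rw [sum_congr rfl fun j _ => sum_congr rfl fun j' _ => e j j']
  simp only [sum_add_distrib]
  have e1 : ∀ n, (∑ j : Fin (m + 1), ∑ j' : Fin (m + 1),
      if (j' : ℕ) = n + 1 + j then a j * a j' else 0) = maACF a (n + 1) := by
    intro n
    rw [maACF, sum_comm]
    exact sum_congr rfl fun j' _ => sum_congr rfl fun j _ => by rw [mul_comm]
  have hT1 : (∑ j : Fin (m + 1), ∑ j' : Fin (m + 1), ∑ n ∈ range (m + 1),
      if (j : ℕ) = n + j' then a j * a j' else 0) = ∑ n ∈ range (m + 1), maACF a n :=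
    calc _ = ∑ j : Fin (m + 1), ∑ n ∈ range (m + 1), ∑ j' : Fin (m + 1),
          if (j : ℕ) = n + j' then a j * a j' else 0 := sum_congr rfl fun j _ => Finset.sum_comm
      _ = ∑ n ∈ range (m + 1), ∑ j : Fin (m + 1), ∑ j' : Fin (m + 1),
          if (j : ℕ) = n + j' then a j * a j' else 0 := Finset.sum_comm
      _ = _ := rfl
  have hT2 : (∑ j : Fin (m + 1), ∑ j' : Fin (m + 1), ∑ n ∈ range m,
      if (j' : ℕ) = n + 1 + j then a j * a j' else 0) = ∑ n ∈ range m, maACF a (n + 1) :=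
    calc _ = ∑ j : Fin (m + 1), ∑ n ∈ range m, ∑ j' : Fin (m + 1),
          if (j' : ℕ) = n + 1 + j then a j * a j' else 0 := sum_congr rfl fun j _ => Finset.sum_comm
      _ = ∑ n ∈ range m, ∑ j : Fin (m + 1), ∑ j' : Fin (m + 1),
          if (j' : ℕ) = n + 1 + j then a j * a j' else 0 := Finset.sum_comm
      _ = _ := sum_congr rfl fun n _ => e1 n
  rw [hT1, hT2, sum_range_succ', two_mul]
  ring

end Combinatorics

/-! ## The moving average of an i.i.d. square-integrable sequence -/

section IID

variable {Ω : Type*} [MeasurableSpace Ω] {P : Measure Ω} [IsProbabilityMeasure P]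
variable {ξ : ℕ → Ω → ℝ} {m : ℕ}

omit [IsProbabilityMeasure P] in
/-- `X_0 ∈ L²` when `ξ_0 ∈ L²`. -/
theorem memLp_blockFactor_maMap (hid : ∀ i, IdentDistrib (ξ i) (ξ 0) P P)
    (h2 : MemLp (ξ 0) 2 P) (a : Fin (m + 1) → ℝ) : MemLp (blockFactor (maMap a) ξ 0) 2 P := by
  rw [show blockFactor (maMap a) ξ 0 = fun ω => ∑ j : Fin (m + 1), a j * ξ (0 + j) ω from
    funext fun ω => blockFactor_maMap a ξ 0 ω]
  exact memLp_finsetSum _ fun j _ => ((hid (0 + j)).symm.memLp_snd h2).const_mul _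

omit [IsProbabilityMeasure P] in
/-- The covariances of an i.i.d. sequence: `cov[ξ_p, ξ_q] = Var(ξ_0) [p = q]`. -/
theorem covariance_iid (hξ : ∀ i, Measurable (ξ i)) (hind : iIndepFun ξ P)
    (hid : ∀ i, IdentDistrib (ξ i) (ξ 0) P P) (h2 : MemLp (ξ 0) 2 P) (p q : ℕ) :
    cov[ξ p, ξ q; P] = if p = q then Var[ξ 0; P] else 0 := by
  split_ifs with h
  · subst h
    rw [covariance_self (hξ p).aemeasurable, (hid p).variance_eq]
  · exact (hind.indepFun h).covariance_eq_zero ((hid p).symm.memLp_snd h2) ((hid q).symm.memLp_snd h2)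

/-- **The autocovariance of the moving average is `Var(ξ_0) · γ`**: `cov[X_0, X_k] = Var(ξ_0) maACF a k`. -/
theorem covariance_blockFactor_maMap (hξ : ∀ i, Measurable (ξ i)) (hind : iIndepFun ξ P)
    (hid : ∀ i, IdentDistrib (ξ i) (ξ 0) P P) (h2 : MemLp (ξ 0) 2 P) (a : Fin (m + 1) → ℝ) (k : ℕ) :
    cov[blockFactor (maMap a) ξ 0, blockFactor (maMap a) ξ k; P] = Var[ξ 0; P] * maACF a k := by
  have hm : ∀ i (j : Fin (m + 1)), MemLp (fun ω => a j * ξ (i + j) ω) 2 P :=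
    fun i j => ((hid (i + j)).symm.memLp_snd h2).const_mul _
  rw [show blockFactor (maMap a) ξ 0 = fun ω => ∑ j : Fin (m + 1), a j * ξ (0 + j) ω from
      funext fun ω => blockFactor_maMap a ξ 0 ω,
    show blockFactor (maMap a) ξ k = fun ω => ∑ j : Fin (m + 1), a j * ξ (k + j) ω from
      funext fun ω => blockFactor_maMap a ξ k ω,
    covariance_fun_sum_fun_sum (hm 0) (hm k), maACF, mul_sum]
  refine sum_congr rfl fun j _ => ?_
  rw [mul_sum]
  refine sum_congr rfl fun j' _ => ?_
  rw [covariance_const_mul_left, covariance_const_mul_right, covariance_iid hξ hind hid h2]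
  simp only [zero_add, mul_ite, mul_zero]
  by_cases h : (j : ℕ) = k + j'
  · rw [if_pos h, if_pos h]; ring
  · rw [if_neg h, if_neg h]

/-- **The long-run variance of the moving average is `Var(ξ_0) (Σ_j a_j)²`.** -/
theorem lrVar_blockFactor_maMap (hξ : ∀ i, Measurable (ξ i)) (hind : iIndepFun ξ P)
    (hid : ∀ i, IdentDistrib (ξ i) (ξ 0) P P) (h2 : MemLp (ξ 0) 2 P) (a : Fin (m + 1) → ℝ) :
    lrVar (fun k => cov[blockFactor (maMap a) ξ 0, blockFactor (maMap a) ξ k; P]) m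
      = Var[ξ 0; P] * (∑ j, a j) ^ 2 := by
  simp only [covariance_blockFactor_maMap hξ hind hid h2, sq_sum_eq_lrVar_maACF, lrVar, mul_sum,
    mul_add, ← mul_assoc]
  congr 1
  exact sum_congr rfl fun n _ => by ring

/-- **THE CLT FOR A MOVING AVERAGE OF AN I.I.D. SQUARE-INTEGRABLE SEQUENCE** (any innovation law;
Lehmann 1999 Example 2.8.1 for general `m`): with `X_i = Σ_{j≤m} a_j ξ_{i+j}` and `Y ~ N(0, Var(ξ_0)(Σ_j a_j)²)`,
`(√N)⁻¹ Σ_{i<N} (X_i − E X_0) ⇒ Y`. -/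
theorem tendstoInDistribution_movingAverage {Ω' : Type*} [MeasurableSpace Ω'] {P' : Measure Ω'}
    [IsProbabilityMeasure P'] (hξ : ∀ i, Measurable (ξ i)) (hind : iIndepFun ξ P)
    (hid : ∀ i, IdentDistrib (ξ i) (ξ 0) P P) (h2 : MemLp (ξ 0) 2 P) (a : Fin (m + 1) → ℝ)
    {Y : Ω' → ℝ} (hY : HasLaw Y (gaussianReal 0 (Var[ξ 0; P] * (∑ j, a j) ^ 2).toNNReal) P') :
    TendstoInDistribution
      (fun (N : ℕ) ω => (Real.sqrt N)⁻¹ * ∑ i ∈ range N,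
        (blockFactor (maMap a) ξ i ω - P[blockFactor (maMap a) ξ 0]))
      atTop Y (fun _ => P) P' := by
  rw [← lrVar_blockFactor_maMap hξ hind hid h2 a] at hY
  exact tendstoInDistribution_blockFactor hξ hind hid (measurable_maMap a)
    (memLp_blockFactor_maMap hid h2 a) hY

end IID

end Summit.Ventures.LatticeQCDFlow.Scoring

end
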